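import Summits.KontsevichZagierPeriods.KontsevichZagierPeriods.Theses.ScissorsAvatars
import Summits.KontsevichZagierPeriods.KontsevichZagierPeriods.Theorems.ScissorsAvatarsDivisibilityScissors
import Literature.NumberTheory.Transcendental.MZVSimplexRepProofs

/-!
# `MzvScissorsSector` (stmt-KontsevichZagierPeriods-4259, route ScissorsAvatars) — line `hoffman-scissors`

Strategist line (alternative to `Lines/birth.lean`; never touches it). The crux (verbatim the route
decl `…Theses.ScissorsAvatars.MzvScissorsSector`): for every weight `w` and every `c` in the subgroup
`Span_w ⊆ KZ.FormalRep` generated by the Kontsevich simplex representations `[mzvRep s]`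
(`s` admissible, `weight s = w`), `KZ.eval c = 0 → c ∈ C12 := closure (domainAddRel ∪ integrandAddRel
∪ changeOfVariablesRel)`.

LEVER. Do the Hoffman normal form DIRECTLY INSIDE THE SCISSORS SUB-CALCULUS `C12`, never passing
through `KZ.relations`: the birth line routes the structural half through `KZ.relations` (stub
`hoffmanNormalForm`, all four rules) and then needs SECTOR DESTABILISATION (stub
`sectorDestabilisation` = route crux `DestabilisedScissors` 4257 on the sector, a conservativity
statement about the WHOLE calculus: "Newton–Leibniz only changes dimension"). Here the structural
half is ONE statement with no conservativity content,

* `stub_hoffmanScissorsSpan` — every `c ∈ Span_w` has `N > 0` and `h` in the subgroup generated by the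
  weight-`w` HOFFMAN simplex representations with `N • c − h ∈ C12`;

it is implied by the conjunction of the two birth stubs (`N • c − h ∈ Span_w ∩ relations ⊆ C12` by
sector destabilisation) and implies birth's `hoffmanNormalForm` (`C12 ⊆ relations`), so it is a
strictly cheaper structural target, and it is exactly what the route's thesis (scissors avatars of
the double-shuffle engine: shuffle = order cells, rules 1a+2; stuffle = cubical blow-ups + positive
partial fractions, rules 2+1b; duality = one rule-2 move; Hoffman's relation in depth one = order
polytope + interior Landen chain, rules 1a/1b/2 — the sibling line `two-posets-interior-landen` on
`MzvKernelInKZ` uses NO Newton–Leibniz instance anywhere) predicts. The transcendence half is the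
SHARED wall, stated verbatim as route LinRedNormalForm's item `HoffmanIndependence`
(stmt-KontsevichZagierPeriods-15045; = `MzvKernelInKZ.TwoPosets.HoffmanIndependent`):

* `stub_hoffmanIndependence` — `LinearIndependent ℚ (u : {u // IsHoffman u}) ↦ ζ(u)`.

COMPOSITION (sorry-free, this file): from `LinearIndependent` to "an `h` in the Hoffman span with
`eval h = 0` is `0` in `FormalRep`" by a coordinate/realisation pair `coord`/`realise` on the free
abelian group (no injectivity of `u ↦ mzvRep u` is needed: coordinates are CHOSEN Hoffman indices);
then `N • c ∈ C12` and INTEGER DIVISION IN `C12` is the landed theorem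
`ScissorsAvatars.divisibilityScissors_proof` (item 4262, Theorems/ScissorsAvatarsDivisibilityScissors.lean).

Disproof used: none on file for this crux (no `Cruxes/MzvScissorsSector/Disproof.lean`, no
`Theorems/MzvScissorsSector/Negative/*`). Checked against the sibling negatives
`Theorems/MzvKernelInKZ/Negative/Core.lean`: `not_withoutEval` (honoured — `eval` enters only through
`stub_hoffmanIndependence`'s use on `h`), `withoutClosure_iff_summit` (honoured — everything is
restricted to `Span_w` / the Hoffman span); and against
`Theorems/HoffmanRelationInKZ/Negative/NoStokesLocality.lean` (`noStokes_locality`: an NL-free proof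
of Hoffman's relation is a chain in ONE dimension — consistent with, indeed the reason for, stating
the structural stub inside `C12` in dimension `w`).
-/

set_option linter.dupNamespace false

noncomputable section

namespace Summit.KontsevichZagierPeriods.KontsevichZagierPeriods.Cruxes.MzvScissorsSector.HoffmanScissors

open Literature.NumberTheory.Transcendental
open Summit.KontsevichZagierPeriods.KontsevichZagierPeriods.Theses.ScissorsAvatars (MzvScissorsSector)

/-! ## Stubs -/

/-- Stub 1 (HOFFMAN NORMAL FORM INSIDE THE SCISSORS SUB-CALCULUS, homogeneous): every `c` in the
subgroup generated by the weight-`w` Kontsevich simplex representations has `N > 0` and an `h` in the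
subgroup generated by the weight-`w` HOFFMAN simplex representations (`u ∈ {2,3}^×`) with
`N • c − h ∈ C12 := closure (domainAddRel ∪ integrandAddRel ∪ changeOfVariablesRel)` — rules 1a, 1b, 2
only, inside `ℝ^w`. Per weight it follows from: finite double shuffle in `C12` (shuffle = order-cell
dissection + coordinate permutations; stuffle = cubical charts + positive three-term partial
fractions), duality in `C12` (one move, `MzvKernelInKZ.Negative.duality_mem_changeOfVariablesRel`),
Hoffman's relation in `C12` (depth one: order polytope + interior Landen chain; deep: open), and the
per-weight EDS certificates `MzvKernelInKZ.TwoPosets.EdsCertificate w` (kernel-checked in the tree for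
small `w`). Why it might fail: Hoffman's relation in depth ≥ 2 (or some EDS generator) may admit no
chain without a Newton–Leibniz detour through dimension `w + 1` (cf. `noStokes_locality`), or EDS
may be incomplete in some weight. Sources: IharaKanekoZagier2006 §1 + Conj. 1, Brown2012 Thm 1.1,
Souderes2010 (arXiv:0808.0248) Prop 1.3/1.5, KanekoYamamoto2018 Thm 4.1, BrownCarrSchneps2010,
KontsevichZagier2001 §1.2. -/
theorem stub_hoffmanScissorsSpan : ∀ (w : ℕ) (c : Literature.NumberTheory.Transcendental.KZ.FormalRep), c ∈ AddSubgroup.closure {x : Literature.NumberTheory.Transcendental.KZ.FormalRep | ∃ (s : List ℕ) (hs : Literature.NumberTheory.Transcendental.MZV.IsAdmissible s), Literature.NumberTheory.Transcendental.MZV.weight s = w ∧ x = Literature.NumberTheory.Transcendental.KZ.of (Literature.NumberTheory.Transcendental.KZ.mzvRep s hs (Literature.NumberTheory.Transcendental.KZ.mzvIntegrand_isSemialgebraicFunOn_holds s) (Literature.NumberTheory.Transcendental.KZ.mzvIntegrand_integrableOn_holds s hs))} → ∃ (N : ℕ) (h : Literature.NumberTheory.Transcendental.KZ.FormalRep), 0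 < N ∧ h ∈ AddSubgroup.closure {x : Literature.NumberTheory.Transcendental.KZ.FormalRep | ∃ (s : List ℕ) (hs : Literature.NumberTheory.Transcendental.MZV.IsAdmissible s), Literature.NumberTheory.Transcendental.MZV.IsHoffman s ∧ Literature.NumberTheory.Transcendental.MZV.weight s = w ∧ x = Literature.NumberTheory.Transcendental.KZ.of (Literature.NumberTheory.Transcendental.KZ.mzvRep s hs (Literature.NumberTheory.Transcendental.KZ.mzvIntegrand_isSemialgebraicFunOn_holds s) (Literature.NumberTheory.Transcendental.KZ.mzvIntegrand_integrableOn_holds s hs))} ∧ N • c - h ∈ AddSubgroup.closure (Literature.NumberTheory.Transcendental.KZ.domainAddRel ∪ Literature.NumberTheory.Transcendental.KZ.integrandAddRel ∪ Literature.NumberTheory.Transcendental.KZ.changeOfVariablesRel) := by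
  sorry

/-- Stub 2 (HOFFMAN INDEPENDENCE — the declared, shared transcendence input, verbatim route
LinRedNormalForm's item `HoffmanIndependence`, stmt-KontsevichZagierPeriods-15045, and
`MzvKernelInKZ.TwoPosets.HoffmanIndependent`): the real Hoffman values `ζ(u)`, `u ∈ {2,3}^×`, are
`ℚ`-linearly independent. Given Brown's theorem (`hoffmanSpan_eq_mzvSpace`, named fact) it is Zagier's
conjecture (`ZagierConjecture`; bridge landed in `Theorems/MzvKernelInKZTwoPosetsHoffmanIndependence.lean`).
Why it might fail: fails iff ONE `ℚ`-linear relation among real Hoffman MZVs exists (none known or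
expected); unreachable by present transcendence methods — neither provable nor cheaply killable.
Sources: Zagier1994 §9, Brown2012, Hoffman1997, GoncharovECM2001 Conj. 1.1. -/
theorem stub_hoffmanIndependence : LinearIndependent ℚ (fun u : {u : List ℕ // Literature.NumberTheory.Transcendental.MZV.IsHoffman u} => Literature.NumberTheory.Transcendental.multipleZeta u.1) := by
  sorry

/-! ## Coordinates on the Hoffman span (sorry-free bookkeeping) -/

/-- Hoffman indices. [folklore] -/
abbrev HIdx : Type := {u : List ℕ // MZV.IsHoffman u}

/-- The simplex-representation generator `[mzvRep u]` of a Hoffman index. [folklore] -/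
def ofH (u : HIdx) : KZ.FormalRep :=
  KZ.of (KZ.mzvRep u.1 u.2.isAdmissible (KZ.mzvIntegrand_isSemialgebraicFunOn_holds u.1)
    (KZ.mzvIntegrand_integrableOn_holds u.1 u.2.isAdmissible))

open scoped Classical in
/-- Coordinates: a generator which IS a Hoffman generator `ofH u` goes to `single u 1` (for a CHOSEN
such `u`), every other generator to `0`. [folklore] -/
def coord : KZ.FormalRep →+ (HIdx →₀ ℤ) :=
  FreeAbelianGroup.lift fun p =>
    if h : ∃ u : HIdx, FreeAbelianGroup.of p = ofH u then Finsupp.single h.choose 1 else 0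

/-- Realisation of integer coordinate vectors: `f ↦ Σ_u f u • [mzvRep u]`. [folklore] -/
def realise : (HIdx →₀ ℤ) →+ KZ.FormalRep :=
  Finsupp.liftAddHom fun u => zmultiplesHom KZ.FormalRep (ofH u)

/-- `realise (single u n) = n • [mzvRep u]`. [folklore] -/
theorem realise_single (u : HIdx) (n : ℤ) : realise (Finsupp.single u n) = n • ofH u := by
  simp [realise]

/-- On a Hoffman generator, `realise ∘ coord` is the identity. [folklore] -/
theorem realise_coord_ofH (u : HIdx) : realise (coord (ofH u)) = ofH u := by
  have hex : ∃ v : HIdx, ofH u = ofH v := ⟨u, rfl⟩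
  have hc : coord (ofH u) = Finsupp.single hex.choose 1 := by
    show FreeAbelianGroup.lift _ (FreeAbelianGroup.of _) = _
    rw [FreeAbelianGroup.lift_apply_of]
    exact dif_pos hex
  rw [hc, realise_single, one_zsmul]
  exact hex.choose_spec.symm

/-- On the subgroup generated by the weight-`w` Hoffman simplex representations, `realise ∘ coord`
is the identity. [folklore] -/
theorem realise_coord_eq {w : ℕ} {h : KZ.FormalRep}
    (hh : h ∈ AddSubgroup.closure {x : KZ.FormalRep | ∃ (s : List ℕ) (hs : MZV.IsAdmissible s),
      MZV.IsHoffman s ∧ MZV.weight s = w ∧ x = KZ.of (KZ.mzvRep s hs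
        (KZ.mzvIntegrand_isSemialgebraicFunOn_holds s) (KZ.mzvIntegrand_integrableOn_holds s hs))}) :
    realise (coord h) = h := by
  refine AddSubgroup.closure_induction (fun x hx => ?_) ?_ (fun x y _ _ hx hy => ?_)
    (fun x _ hx => ?_) hh
  · obtain ⟨s, hs, hH, -, rfl⟩ := hx
    exact realise_coord_ofH ⟨s, hH⟩
  · simp
  · rw [map_add, map_add, hx, hy]
  · rw [map_neg, map_neg, hx]

/-- Evaluation of a realised coordinate vector: `eval (Σ f u • [mzvRep u]) = Σ f u • ζ(u)`
(Kontsevich's formula `KZ.mzvRep_value_holds`). [cite: KontsevichZagier2001, §1.1] -/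
theorem eval_realise (f : HIdx →₀ ℤ) :
    KZ.eval (realise f) = f.sum fun u n => n • multipleZeta u.1 := by
  rw [realise, Finsupp.liftAddHom_apply, map_finsuppSum]
  refine Finsupp.sum_congr fun u _ => ?_
  rw [zmultiplesHom_apply, map_zsmul, ofH, KZ.eval_of, KZ.mzvRep_value_holds]

/-- **Hoffman independence in `FormalRep` terms**: under `ℚ`-linear independence of the real Hoffman
values, an `h` in the subgroup generated by the weight-`w` Hoffman simplex representations with
`KZ.eval h = 0` is `0` (this is birth's `stub_hoffmanIndependence`, now DERIVED from item 15045's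
statement). [cite: Brown2012, Thm 1.1] -/
theorem hoffSpan_eq_zero_of_eval_eq_zero
    (hI : LinearIndependent ℚ (fun u : {u : List ℕ // MZV.IsHoffman u} => multipleZeta u.1))
    {w : ℕ} {h : KZ.FormalRep}
    (hh : h ∈ AddSubgroup.closure {x : KZ.FormalRep | ∃ (s : List ℕ) (hs : MZV.IsAdmissible s),
      MZV.IsHoffman s ∧ MZV.weight s = w ∧ x = KZ.of (KZ.mzvRep s hs
        (KZ.mzvIntegrand_isSemialgebraicFunOn_holds s) (KZ.mzvIntegrand_integrableOn_holds s hs))})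
    (h0 : KZ.eval h = 0) : h = 0 := by
  set f : HIdx →₀ ℤ := coord h with hf
  have hreal : realise f = h := realise_coord_eq hh
  -- the rational coordinate vector
  set l : HIdx →₀ ℚ := Finsupp.mapRange (Int.cast : ℤ → ℚ) (by simp) f with hl
  have hcomb : Finsupp.linearCombination ℚ
      (fun u : {u : List ℕ // MZV.IsHoffman u} => multipleZeta u.1) l = 0 := by
    rw [Finsupp.linearCombination_apply, hl,
      Finsupp.sum_mapRange_index (h := fun (i : HIdx) (a : ℚ) => a • multipleZeta i.1)
        (fun _ => zero_smul _ _)]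
    have : (f.sum fun u (n : ℤ) => (n : ℚ) • multipleZeta u.1) = f.sum fun u n => n • multipleZeta u.1 :=
      Finsupp.sum_congr fun u _ => Int.cast_smul_eq_zsmul ℚ _ _
    rw [this, ← eval_realise, hreal, h0]
  have hl0 : l = 0 := linearIndependent_iff.mp hI l hcomb
  have hf0 : f = 0 := by
    have hinj := Finsupp.mapRange_injective (Int.cast : ℤ → ℚ) (by simp) Int.cast_injective
      (α := HIdx)
    apply hinj
    rw [← hl, hl0, Finsupp.mapRange_zero]
  rw [← hreal, hf0, map_zero]

/-! ## The composition (sorry-free) -/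

/-- **Skeleton theorem, arrow form** (concludes the crux BY NAME): Hoffman normal form inside `C12` →
Hoffman independence → `MzvScissorsSector`. Given `c ∈ Span_w` with `eval c = 0`: stub 1 gives
`N > 0`, `h ∈ HoffSpan_w`, `N • c − h ∈ C12 ⊆ relations ⊆ ker eval` (soundness,
`KZ.relations_le_ker_eval_holds`), so `eval h = 0`, so `h = 0` (`hoffSpan_eq_zero_of_eval_eq_zero`),
so `N • c ∈ C12`, so `c ∈ C12` by INTEGER DIVISION IN `C12` — the landed item `DivisibilityScissors`
(`ScissorsAvatars.divisibilityScissors_proof`). [folklore] -/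
theorem MzvScissorsSector_of :
    (∀ (w : ℕ) (c : Literature.NumberTheory.Transcendental.KZ.FormalRep), c ∈ AddSubgroup.closure {x : Literature.NumberTheory.Transcendental.KZ.FormalRep | ∃ (s : List ℕ) (hs : Literature.NumberTheory.Transcendental.MZV.IsAdmissible s), Literature.NumberTheory.Transcendental.MZV.weight s = w ∧ x = Literature.NumberTheory.Transcendental.KZ.of (Literature.NumberTheory.Transcendental.KZ.mzvRep s hs (Literature.NumberTheory.Transcendental.KZ.mzvIntegrand_isSemialgebraicFunOn_holds s) (Literature.NumberTheory.Transcendental.KZ.mzvIntegrand_integrableOn_holds s hs))} → ∃ (N : ℕ) (h : Literature.NumberTheory.Transcendental.KZ.FormalRep), 0 < N ∧ h ∈ AddSubgroup.closure {x : Literature.NumberTheory.Transcendental.KZ.FormalRep | ∃ (s : List ℕ) (hs : Literature.NumberTheory.Transcendental.MZV.IsAdmissible s), Literature.NumberTheory.Transcendental.MZV.IsHoffman s ∧ Literature.NumberTheory.Transcendental.MZV.weight s = w ∧ x = Literature.NumberTheory.Transcendental.KZ.of (Literature.NumberTheory.Transcendental.KZ.mzvRep s hs (Literature.NumberTheory.Transcendental.KZ.mzvIntegrand_isSemialgebraicFunOn_holds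 s) (Literature.NumberTheory.Transcendental.KZ.mzvIntegrand_integrableOn_holds s hs))} ∧ N • c - h ∈ AddSubgroup.closure (Literature.NumberTheory.Transcendental.KZ.domainAddRel ∪ Literature.NumberTheory.Transcendental.KZ.integrandAddRel ∪ Literature.NumberTheory.Transcendental.KZ.changeOfVariablesRel)) →
    LinearIndependent ℚ (fun u : {u : List ℕ // Literature.NumberTheory.Transcendental.MZV.IsHoffman u} => Literature.NumberTheory.Transcendental.multipleZeta u.1) →
    MzvScissorsSector := by
  intro hS hI w c hc hc0
  obtain ⟨N, h, hN, hh, h12⟩ := hS w c hc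
  have hrel : N • c - h ∈ KZ.relations := AddSubgroup.closure_mono Set.subset_union_left h12
  have hker : KZ.eval (N • c - h) = 0 := AddMonoidHom.mem_ker.1 (KZ.relations_le_ker_eval_holds hrel)
  have hh0 : KZ.eval h = 0 := by
    rw [map_sub, map_nsmul, hc0, smul_zero, zero_sub, neg_eq_zero] at hker
    exact hker
  have h0 : h = 0 := hoffSpan_eq_zero_of_eval_eq_zero hI hh hh0
  rw [h0, sub_zero] at h12
  exact Summit.KontsevichZagierPeriods.ScissorsAvatars.divisibilityScissors_proof c N hN h12

/-- **Skeleton theorem, by name**: `MzvScissorsSector` from the two declared stubs. -/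
theorem MzvScissorsSector_skeleton : MzvScissorsSector :=
  MzvScissorsSector_of stub_hoffmanScissorsSpan stub_hoffmanIndependence

/-! ## Ties to the birth line (sorry-free): this line's stubs versus `Lines/birth.lean` -/

/-- Stub 1 here follows from the conjunction of birth's stubs 1 (`sectorDestabilisation`) and 2
(`hoffmanNormalForm`): the Hoffman span lies in `Span_w`, so `N • c − h ∈ Span_w ∩ relations`, which
sector destabilisation puts in `C12`. (So this line asks STRICTLY LESS structure than birth.) [folklore] -/
theorem stub_hoffmanScissorsSpan_of_birth
    (hD : ∀ (w : ℕ) (c : KZ.FormalRep), c ∈ AddSubgroup.closure {x : KZ.FormalRep | ∃ (s : List ℕ) (hs : MZV.IsAdmissible s), MZV.weight s = w ∧ x = KZ.of (KZ.mzvRep s hs (KZ.mzvIntegrand_isSemialgebraicFunOn_holds s) (KZ.mzvIntegrand_integrableOn_holds s hs))} → c ∈ KZ.relations → c ∈ AddSubgroup.closure (KZ.domainAddRel ∪ KZ.integrandAddRel ∪ KZ.changeOfVariablesRel))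
    (hN : ∀ (w : ℕ) (c : KZ.FormalRep), c ∈ AddSubgroup.closure {x : KZ.FormalRep | ∃ (s : List ℕ) (hs : MZV.IsAdmissible s), MZV.weight s = w ∧ x = KZ.of (KZ.mzvRep s hs (KZ.mzvIntegrand_isSemialgebraicFunOn_holds s) (KZ.mzvIntegrand_integrableOn_holds s hs))} → ∃ (N : ℕ) (h : KZ.FormalRep), 0 < N ∧ h ∈ AddSubgroup.closure {x : KZ.FormalRep | ∃ (s : List ℕ) (hs : MZV.IsAdmissible s), MZV.IsHoffman s ∧ MZV.weight s = w ∧ x = KZ.of (KZ.mzvRep s hs (KZ.mzvIntegrand_isSemialgebraicFunOn_holds s) (KZ.mzvIntegrand_integrableOn_holds s hs))} ∧ N • c - h ∈ KZ.relations) :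
    ∀ (w : ℕ) (c : KZ.FormalRep), c ∈ AddSubgroup.closure {x : KZ.FormalRep | ∃ (s : List ℕ) (hs : MZV.IsAdmissible s), MZV.weight s = w ∧ x = KZ.of (KZ.mzvRep s hs (KZ.mzvIntegrand_isSemialgebraicFunOn_holds s) (KZ.mzvIntegrand_integrableOn_holds s hs))} → ∃ (N : ℕ) (h : KZ.FormalRep), 0 < N ∧ h ∈ AddSubgroup.closure {x : KZ.FormalRep | ∃ (s : List ℕ) (hs : MZV.IsAdmissible s), MZV.IsHoffman s ∧ MZV.weight s = w ∧ x = KZ.of (KZ.mzvRep s hs (KZ.mzvIntegrand_isSemialgebraicFunOn_holds s) (KZ.mzvIntegrand_integrableOn_holds s hs))} ∧ N • c - h ∈ AddSubgroup.closure (KZ.domainAddRel ∪ KZ.integrandAddRel ∪ KZ.changeOfVariablesRel) := by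
  intro w c hc
  obtain ⟨N, h, hNpos, hh, hrel⟩ := hN w c hc
  refine ⟨N, h, hNpos, hh, hD w _ ?_ hrel⟩
  have hsub : AddSubgroup.closure {x : KZ.FormalRep | ∃ (s : List ℕ) (hs : MZV.IsAdmissible s), MZV.IsHoffman s ∧ MZV.weight s = w ∧ x = KZ.of (KZ.mzvRep s hs (KZ.mzvIntegrand_isSemialgebraicFunOn_holds s) (KZ.mzvIntegrand_integrableOn_holds s hs))} ≤ AddSubgroup.closure {x : KZ.FormalRep | ∃ (s : List ℕ) (hs : MZV.IsAdmissible s), MZV.weight s = w ∧ x = KZ.of (KZ.mzvRep s hs (KZ.mzvIntegrand_isSemialgebraicFunOn_holds s) (KZ.mzvIntegrand_integrableOn_holds s hs))} := by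
    refine AddSubgroup.closure_mono ?_
    rintro x ⟨s, hs, -, hw, rfl⟩
    exact ⟨s, hs, hw, rfl⟩
  exact sub_mem (AddSubgroup.nsmul_mem _ hc N) (hsub hh)

/-- Conversely stub 1 here implies birth's stub 2 (`hoffmanNormalForm`), since `C12 ⊆ relations`. [folklore] -/
theorem birth_hoffmanNormalForm_of_stub
    (hS : ∀ (w : ℕ) (c : KZ.FormalRep), c ∈ AddSubgroup.closure {x : KZ.FormalRep | ∃ (s : List ℕ) (hs : MZV.IsAdmissible s), MZV.weight s = w ∧ x = KZ.of (KZ.mzvRep s hs (KZ.mzvIntegrand_isSemialgebraicFunOn_holds s) (KZ.mzvIntegrand_integrableOn_holds s hs))} → ∃ (N : ℕ) (h : KZ.FormalRep), 0 < N ∧ h ∈ AddSubgroup.closure {x : KZ.FormalRep | ∃ (s : List ℕ) (hs : MZV.IsAdmissible s), MZV.IsHoffman s ∧ MZV.weight s = w ∧ x = KZ.of (KZ.mzvRep s hs (KZ.mzvIntegrand_isSemialgebraicFunOn_holds s) (KZ.mzvIntegrand_integrableOn_holds s hs))} ∧ N • c - h ∈ AddSubgroup.closure (KZ.domainAddRel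 ∪ KZ.integrandAddRel ∪ KZ.changeOfVariablesRel)) :
    ∀ (w : ℕ) (c : KZ.FormalRep), c ∈ AddSubgroup.closure {x : KZ.FormalRep | ∃ (s : List ℕ) (hs : MZV.IsAdmissible s), MZV.weight s = w ∧ x = KZ.of (KZ.mzvRep s hs (KZ.mzvIntegrand_isSemialgebraicFunOn_holds s) (KZ.mzvIntegrand_integrableOn_holds s hs))} → ∃ (N : ℕ) (h : KZ.FormalRep), 0 < N ∧ h ∈ AddSubgroup.closure {x : KZ.FormalRep | ∃ (s : List ℕ) (hs : MZV.IsAdmissible s), MZV.IsHoffman s ∧ MZV.weight s = w ∧ x = KZ.of (KZ.mzvRep s hs (KZ.mzvIntegrand_isSemialgebraicFunOn_holds s) (KZ.mzvIntegrand_integrableOn_holds s hs))} ∧ N • c - h ∈ KZ.relations := by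
  intro w c hc
  obtain ⟨N, h, hNpos, hh, h12⟩ := hS w c hc
  exact ⟨N, h, hNpos, hh, AddSubgroup.closure_mono Set.subset_union_left h12⟩

/-- And birth's stub 3 (`hoffmanIndependence` in `FormalRep` terms) follows from stub 2 here. [folklore] -/
theorem birth_hoffmanIndependence_of_stub
    (hI : LinearIndependent ℚ (fun u : {u : List ℕ // MZV.IsHoffman u} => multipleZeta u.1)) :
    ∀ (w : ℕ) (h : KZ.FormalRep), h ∈ AddSubgroup.closure {x : KZ.FormalRep | ∃ (s : List ℕ) (hs : MZV.IsAdmissible s), MZV.IsHoffman s ∧ MZV.weight s = w ∧ x = KZ.of (KZ.mzvRep s hs (KZ.mzvIntegrand_isSemialgebraicFunOn_holds s) (KZ.mzvIntegrand_integrableOn_holds s hs))} → KZ.eval h = 0 → h = 0 :=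
  fun _ _ hh h0 => hoffSpan_eq_zero_of_eval_eq_zero hI hh h0

end Summit.KontsevichZagierPeriods.KontsevichZagierPeriods.Cruxes.MzvScissorsSector.HoffmanScissors
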